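import Mathlib
import HarnessLib
import Summits.NavierStokesRegularity.NavierStokesRegularity.Theorems.UnthreadedRigidityDoorUnthreadedRigidityVirialHornBracketAll
import Summits.NavierStokesRegularity.NavierStokesRegularity.Theorems.UnthreadedRigidityDoorUnthreadedRigidityVirialHornWedgeEuler
import Summits.NavierStokesRegularity.NavierStokesRegularity.Theorems.UnthreadedRigidityDoorUnthreadedRigidityThreadingJetsSlice

/-!
# Route `UnthreadedRigidityDoor`, item `UnthreadedRigidity` (W2, stmt-NavierStokesRegularity-27585) — LINE g11-1 «VIRIAL HORN»:
# the SLICE WEDGE LAW and ISOTYPIC ORDER-ONE RIGIDITY IN EVERY DEGREE, UNCONDITIONALLY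

Prover file (W2 Lean hand ns-crc-p2 g11, by lineage; `--supports stmt-NavierStokesRegularity-27585`, helper; 0 kit).  ns-crc-p2 g8's SLICE WEDGE LAW
`wedgeVanishesL_of_fluxJetOne_eq_zero` (`…VirialHornWedgeEuler`, p711197) carried the bracket injectivity of the family `B` as a HYPOTHESIS `hinj`;
g10's `bracketInjective_all` (p729108) proves that hypothesis for every linearly independent family of solid harmonics of every degree `l ≥ 1`.
This file records the two unconditional statements that result — the degree-`l` twins, in the VIRIAL HORN currency, of the PRESSURE HORN rung I1
`PressureHorn.IsotypicOrderOneRigidity` (landed for `l = 2` forms as `HornPressure.isotypicOrderOneRigidity_holds`, p731734):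

* ★ `wedgeVanishesL_of_fluxJetOne` — SLICE WEDGE LAW: for an admissible `l`-isotypic family (`l ≥ 1`) over a linearly independent family of solid
  harmonics, if the formal first threading jet of `isoShellL n c B x₀` about `x₀` vanishes identically then every radial Wronskian
  `c_m c_{m′}′ − c_{m′} c_m′` vanishes on `(0,∞)` (`WedgeVanishesL n c`: the datum is PIECEWISE SEPARABLE);
* ★★ `isoOrderOneRigidity_all` — ISOTYPIC ORDER-ONE RIGIDITY, every degree: an admissible `l`-isotypic datum over an independent family, left-end
  slice of a classical solution on `[t₀,T)` whose threading flux about `x₀` has vanishing one-sided FIRST jet at `t₀`, is piecewise separable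
  (M-part `ThreadingJets.derivWithin_threadingFlux_Ici_eq_fluxJetOne` + the slice wedge law).

HONEST LABEL: compositions of landed files about SPECIAL (isotypic) slices; neither statement is a registered decl of the line (the line types the
WINDOW form, bridge W `WindowWedgeAnalyticL`, already a theorem: `windowWedgeAnalyticL_holds`); `UnthreadedRigidity` ⟨27585⟩, W2 and NS regularity
remain OPEN; no summit statement is proved here.  [folklore]
-/

-- the summit and its single sub-problem share the name (CONVENTIONS §1), as in every Theorems file
set_option linter.dupNamespace false

noncomputable section

namespace Summit.NavierStokesRegularity.NavierStokesRegularity.Theorems.UnthreadedRigidity.VirialHorn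

open scoped Topology
open Filter Set
open Literature.Analysis.FluidPDE
open Summit.NavierStokesRegularity.NavierStokesRegularity.Theorems.UnthreadedRigidity.ProfileHorn (E3 threadingFlux)
open Summit.NavierStokesRegularity.NavierStokesRegularity.Theorems.UnthreadedRigidity.ThreadingJets (fluxJetOne derivWithin_threadingFlux_Ici_eq_fluxJetOne)

/-- ★ **THE SLICE WEDGE LAW, UNCONDITIONALLY**: for an admissible `l`-isotypic family (`l ≥ 1`) over a LINEARLY INDEPENDENT family of solid
harmonics, identical vanishing of the formal first threading jet of `isoShellL n c B x₀` about `x₀` forces all radial Wronskians of the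
coefficient profiles to vanish on `(0,∞)` (g8's `wedgeVanishesL_of_fluxJetOne_eq_zero` with its injectivity hypothesis discharged by
g10's `bracketInjective_all`).  SPECIAL data; ⟨27585⟩ / W2 / NS regularity OPEN. -/
theorem wedgeVanishesL_of_fluxJetOne {l n : ℕ} (hl : 1 ≤ l) {c : Fin n → ℝ → ℝ} {B : Fin n → E3 → ℝ}
    (hadm : IsoAdmissibleL l n c B) (hB : LinearIndependent ℝ B) (x₀ : E3)
    (h0 : ∀ x : E3, fluxJetOne (isoShellL n c B x₀) x₀ x = 0) :
    WedgeVanishesL n c :=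
  wedgeVanishesL_of_fluxJetOne_eq_zero hl hadm x₀ (fun w hw => bracketInjective_all l n B hl hadm.1 hB w hw) h0

/-- ★★ **ISOTYPIC ORDER-ONE RIGIDITY IN EVERY DEGREE** (the VIRIAL HORN twin of the PRESSURE HORN rung I1, all `l ≥ 1`, any family size `n`):
an admissible `l`-isotypic datum `isoShellL n c B x₀` over a linearly independent family of solid harmonics, left-end slice of a classical
solution on `[t₀, T)`, whose threading flux about `x₀` has vanishing one-sided first jet at `t₀`, is PIECEWISE SEPARABLE: every radial
Wronskian `c_m c_{m′}′ − c_{m′} c_m′` vanishes on `(0,∞)`.  (One-sided jet = formal first jet, then the slice wedge law.)  A statement about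
HYPOTHETICAL isotypic slices (SPECIAL data); ⟨27585⟩, W2 and NS regularity remain OPEN. -/
theorem isoOrderOneRigidity_all (l n : ℕ) (t₀ T : ℝ) (u : ℝ → E3 → E3) (p : ℝ → E3 → ℝ) (x₀ : E3)
    (c : Fin n → ℝ → ℝ) (B : Fin n → E3 → ℝ) (hl : 1 ≤ l) (hT : t₀ < T)
    (hsol : IsClassicalNSSolutionOn (Set.Ico t₀ T) 1 0 u p)
    (hadm : IsoAdmissibleL l n c B) (hB : LinearIndependent ℝ B) (hdat : u t₀ = isoShellL n c B x₀)
    (hj1 : ∀ x : E3, derivWithin (fun t => threadingFlux u x₀ t x) (Set.Ici t₀) t₀ = 0) :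
    WedgeVanishesL n c := by
  refine wedgeVanishesL_of_fluxJetOne hl hadm hB x₀ fun x => ?_
  rw [← hdat, ← derivWithin_threadingFlux_Ici_eq_fluxJetOne hsol hT x₀ x]
  exact hj1 x

end Summit.NavierStokesRegularity.NavierStokesRegularity.Theorems.UnthreadedRigidity.VirialHorn

end
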